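import Summits.QuantumFields.YangMills.Theorems.BalabanUVNodesN22W1PrintedBoxBlock
import Summits.QuantumFields.YangMills.Theorems.BalabanUVNodesN22W1RelCentredSliceInputsL2U
import Literature.MathematicalPhysics.QuantumFieldTheory.Balaban1983to89.B13Lemma3TorusSocket

/-!
# BalabanUVNodes ∕ node N22 = NE9 — LOCATED (A6-class, count-neutral): AT PRINT'S BOXES EVERY INHABITANT OF THE s1 RECORD AT A LARGE-FIELD SLICE TIES THE (2.22)
# GAIN `a`, THE COVARIANCE LETTER `cE` AND THE BASE POINT: `2·a·cE·s₀² ≤ ε₁²` — so with the socket's `a ≥ 80κ` the J-road runs only at base points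
# `s₀ ≤ ε₁ ∕ √(160·κ·cE)` (print's implicit «g_k small against ε₁»; the window of J17-K's `∀ s₀ ∈ ]0, θ.γ]` is capped accordingly)

Cell `pub-ymgap`, HUMAN RULING D-0062 (Track A) ∕ D-0149 (width seats), seat `pub-ymgap-dag-n22-w1` (WIDTH SEAT 1 of 3 on node n22; the «A6-residue flag №3 lane»),
generation 0, file 3.  THEOREMS ONLY (0 `def`, 0 `sorry`); imports this seat's file 1 `…N22W1PrintedBoxBlock`, dag-n22-c's J17-D `…N22W1RelCentredSliceInputsL2U` (the record
`YMDAG.N22.W1.SliceInputsL2U`, p578863) and `B13Lemma3TorusSocket` (`Lemma3Numerics`, the socket numerals the knit J17-K carries as `hN`); restates nothing.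
`--kind proof --supports stmt-QuantumFields-20544 --as helper` (K3⁷ `SpineGivenEndpointR13SepCoPH`).

WHY.  dag-n22-c's knit J17-K asks ONE inhabitant of `SliceInputsL2U … Z t (Wt k′ X) s₀ a a₅ ρb Mv` for EVERY term `t ∈ terms L M Z` — small-field labels `P(t) = ∅` AND
large-field labels `P(t) ≠ ∅` — and EVERY base point `s₀ ∈ ]0, θ.γ]`, with ONE gain letter `a` that also feeds the socket `hN : Lemma3Numerics c M (L∕2) a …` ([II] Lemma 3:
`hR16′ : 4κ ≤ a∕20`, i.e. `a ≥ 80κ`).  File 1 showed that at print's boxes the record's box block holds with the threshold letter FORCED to `rP ≤ ε₁∕s₀`.  THIS FILE turns that into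
a constraint EVERY inhabitant must meet (standing rule №189 ∕ №193, A6: what the located antecedent can and cannot be inhabited with): testing `h222` at the field `B₀ := (ε₁∕s₀)·𝟙_{P}`
(large on every bond of `P`, zero on `Y₀`) gives `γ₂·rP² ≤ γ₂·(ε₁∕s₀)²`, whence with `hPa : a ≤ γ₂rP²` and `hαc_0 : (… + (γ₂ + a₀))·cE ≤ ½` (so `γ₂·cE ≤ ½`):
`2·a·cE·s₀² ≤ ε₁²`; `cE > 0` (it dominates the eigenvalues of the positive covariance `C`); with the socket, `160·κ·cE·s₀² ≤ ε₁²`.  READING: this is print's own regime — (2.22)'s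
gain is `½γ₂ε₁²∕g_k²` per large-field bond BECAUSE `g_k ≪ ε₁` ([II] p. 16; [I] §1 p. 263 «γ sufficiently small») — made quantitative for the J-road's letters: the knit's window
`θ.γ` must satisfy `θ.γ ≤ ε₁∕√(160·κ·cE)` as soon as one large-field term is in range at `s₀ = θ.γ`.  It complements dag-n22-w2's WINDOW-N22-J (`θ.γ² < ½` from the aperture
numeral `hMvγ`); neither is a defect of the record — both are window numerals the datum of record has to carry.

WHAT.
* §1 the test field `B₀ b := if b ∈ Pl then ε∕s₀ else 0`: `testField_dotProduct` (`⟨B₀,B₀⟩ = |Pl|·(ε∕s₀)²`), `chi_smul_testField_eq_one` (boxes on `Y₀` disjoint from `Pl`, `ε > 0`),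
  `chic_smul_testField_eq_one` (`s₀ > 0`).
* §2 for ANY inhabitant `V : SliceInputsL2U 𝔇 χu χcu 𝒲 𝒪 c Sg Rz cs E₀ κE Z t W s₀ a a₅ ρb Mv` whose boxes at `(Z, t)` are print's on row-bond sets `Y₀`, `Pl` (`Disjoint Y₀ Pl`,
  `|Pl| = |P(t)| ≥ 1`): `gamma2_mul_rP_sq_le` (`γ₂·rP² ≤ γ₂·(ε∕s₀)²`), `a_le_gamma2_mul` (`a ≤ γ₂·(ε∕s₀)²`), `gamma2_mul_cE_le_half` (`γ₂·cE ≤ ½`, every inhabitant), `cE_pos`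
  (every inhabitant, `Λ` nonempty), ★ `two_mul_a_mul_cE_mul_sq_le` (`2·a·cE·s₀² ≤ ε²`), `sq_le_of_pos` (`0 < a → s₀² ≤ ε²∕(2·a·cE)`).
* §3 with the socket numerals `Lemma3Numerics c M ℓ a …`: `eighty_kappa_le_a`, ★ `socket_window_cap` (`160·κ·cE·s₀² ≤ ε²`).

HONEST FRAMING — what this is NOT.  Arithmetic on the record's own fields at one explicit test field; count-neutral; NOT a discharge of N22 and NOT a refutation of anything (the
record stays inhabited — file 1 ∕ J17-W — on base points obeying the cap; typed 28∕28 · discharged 5∕27 UNCHANGED; the chair's count line is the only count).  Whether the datum of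
record's window `θ.γ` obeys the cap is the record's numeral to display (def-T ∕ plan), not decided here; `cE`, `κ` are NODE A's ∕ the socket's letters.  One finite four-torus
programme at fixed ε — R4 closes the conditional rung `BalabanLadder.UV` only; NOT continuum, NOT OS, NOT a mass gap, NOT Clay.  0 `sorry`, standard axioms.

References (TYPES ∕ loci only): [II] = [Balaban1988RG2Cluster] (2.3) p. 12, (2.22) p. 16, Lemma 3 p. 20 (R16); [I] = [Balaban1987RG1] §1 p. 263, (2.9) p. 266.
-/

namespace Summit.QuantumFields.YangMills.BalabanUVNodes.N22PrintedBoxBlock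

open Set Metric Matrix
open scoped BigOperators
open Literature.MathematicalPhysics.QuantumFieldTheory.Balaban1983to89
open Literature.MathematicalPhysics.QuantumFieldTheory.Balaban1983to89.TreeLengthTorus (TDom)
open Literature.MathematicalPhysics.QuantumFieldTheory.Balaban1983to89.B13Lemma3TorusSocket (Lemma3Numerics)
open Literature.MathematicalPhysics.QuantumFieldTheory.Balaban1983to89.Step (SFConsts)
open Literature.MathematicalPhysics.QuantumFieldTheory.Balaban1983to89.Node00
open Literature.MathematicalPhysics.QuantumFieldTheory.Balaban1983to89.Node00.Sect2 (domSys domCount CPair Setting Residual)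
open Literature.MathematicalPhysics.QuantumFieldTheory.Balaban1983to89.Node00.W1
open YMDAG.N22.W1 (SliceInputsL2U)

/-! ## §1 The test field: large on `Pl`, zero elsewhere -/

section TestField

variable {Λ : Type*} [Fintype Λ] [DecidableEq Λ]

/-- `⟨B₀, B₀⟩ = |Pl|·(ε∕s₀)²` for the test field `B₀ b := if b ∈ Pl then ε∕s₀ else 0`. [folklore] -/
theorem testField_dotProduct (Pl : Finset Λ) (ε s₀ : ℝ) :
    (fun b => if b ∈ Pl then ε / s₀ else 0) ⬝ᵥ (fun b => if b ∈ Pl then ε / s₀ else 0) = (Pl.card : ℝ) * (ε / s₀) ^ 2 := by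
  simp only [dotProduct]
  have h : ∀ b : Λ, (if b ∈ Pl then ε / s₀ else 0) * (if b ∈ Pl then ε / s₀ else 0) = if b ∈ Pl then (ε / s₀) ^ 2 else 0 := by
    intro b
    split_ifs <;> ring
  simp only [h, Finset.sum_ite_mem, Finset.univ_inter, Finset.sum_const, nsmul_eq_mul]

omit [Fintype Λ] in
/-- At the test field the small-field box on `Y₀` (disjoint from `Pl`) equals `1` for every base point (`ε > 0`). [cite: Balaban1987RG1, (2.9) p.266] -/
theorem chi_smul_testField_eq_one (χu : (Λ → ℝ) → ℝ) (Y₀ Pl : Finset Λ) {ε : ℝ} (hε : 0 < ε)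
    (hχu : ∀ A, χu A = ∏ b ∈ Y₀, (if |A b| < ε then (1 : ℝ) else 0)) (hdisj : Disjoint Y₀ Pl) (s₀ : ℝ) :
    χu (s₀ • fun b => if b ∈ Pl then ε / s₀ else 0) = 1 := by
  rw [hχu, prodBox_eq_one_iff]
  intro b hb
  have hbP : b ∉ Pl := Finset.disjoint_left.1 hdisj hb
  simp only [Pi.smul_apply, smul_eq_mul, hbP, if_false, mul_zero, abs_zero]
  exact hε

omit [Fintype Λ] in
/-- At the test field the large-field function on `Pl` equals `1` (`s₀ > 0`, `ε ≥ 0`): every bond of `Pl` carries `|s₀·B₀(b)| = ε`. [cite: Balaban1988RG2Cluster, (2.3) p.12] -/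
theorem chic_smul_testField_eq_one (χcu : (Λ → ℝ) → ℝ) (Pl : Finset Λ) {ε s₀ : ℝ} (hε : 0 ≤ ε) (hs : 0 < s₀)
    (hχcu : ∀ A, χcu A = ∏ b ∈ Pl, (if ε ≤ |A b| then (1 : ℝ) else 0)) :
    χcu (s₀ • fun b => if b ∈ Pl then ε / s₀ else 0) = 1 := by
  rw [hχcu, prodLarge_eq_one_iff]
  intro b hb
  simp only [Pi.smul_apply, smul_eq_mul, hb, if_true]
  rw [mul_div_cancel₀ ε hs.ne', abs_of_nonneg hε]

end TestField

/-! ## §2 What every print-box inhabitant of the record satisfies at a large-field slice -/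

section Inhabitant

variable {c₀ : B13.Consts} {P : Params} {𝔸 : Type*} [NormedRing 𝔸] [NormedAlgebra ℂ 𝔸] [CompleteSpace 𝔸] {M k L : ℕ} [NeZero L]
  {𝔇 : TermDatum214 c₀ P 𝔸 M k L}
  {χu χcu : (Z : (domSys P M (k + 1)).Dom) → (t : TermLabel P M k L) → ((𝔇.𝒦 Z t).Λ → ℝ) → ℝ}
  {𝒲 : (Z : (domSys P M (k + 1)).Dom) → (t : TermLabel P M k L) → CPair P 𝔸 → TDom P.d (L * domCount P M (k + 1)) → ((𝔇.𝒦 Z t).Λ → ℝ) → ℂ}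
  {𝒪 : (Z : (domSys P M (k + 1)).Dom) → (t : TermLabel P M k L) → OlderTerms P 𝔸 M k → CPair P 𝔸 → TDom P.d (L * domCount P M (k + 1)) →
    ((𝔇.𝒦 Z t).Λ → ℝ) → ℂ}
  {c : B13.Consts} {G : Type*} [GaugeGroup G] {Sg : Setting 𝔸 G} {Rz : Residual P 𝔸} {cs : SFConsts} {E₀ κE : ℝ}
  {Z : (domSys P M (k + 1)).Dom} {t : TermLabel P M k L} {W : Set (CPair P 𝔸)} {s₀ a a₅ ρb Mv : ℝ}

/-- **`γ₂·cE ≤ ½` FOR EVERY INHABITANT** (from `hαc_0 : (2θ(…) + (γ₂ + a₀))·cE ≤ ½`, `θ ≥ θE ≥ 0`, `a₀ ≥ 0`, `cE ≥ 0`). [cite: Balaban1988RG2Cluster, (2.22) p.16 («γ₂ is a small, positive constant»)] -/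
theorem gamma2_mul_cE_le_half (V : SliceInputsL2U 𝔇 χu χcu 𝒲 𝒪 c Sg Rz cs E₀ κE Z t W s₀ a a₅ ρb Mv) : V.γ₂ * V.cE ≤ 1 / 2 := by
  have hθ : 0 ≤ V.θ := V.hθE.trans V.hθEle0
  have hm : 0 ≤ V.θ * (((𝔇.𝒦 Z t).m : ℝ) * (1 + 2 / V.kap'') ^ 𝔇.ν) :=
    mul_nonneg hθ (mul_nonneg (Nat.cast_nonneg _) (pow_nonneg (by have := V.hkap''; positivity) _))
  have h := V.hαc_0
  nlinarith [V.hc0, V.ha₀, V.hγ₂, hm, mul_nonneg (mul_nonneg hθ (mul_nonneg (Nat.cast_nonneg ((𝔇.𝒦 Z t).m)) (pow_nonneg (by have := V.hkap''; positivity) 𝔇.ν))) V.hc0,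
    mul_nonneg V.ha₀ V.hc0]

/-- **`cE > 0` FOR EVERY INHABITANT** once the term has a row bond: `cE` dominates the (positive) eigenvalues of the covariance `C ≻ 0`. [cite: Balaban1988RG2Cluster, (2.14) p.15 (C^{(k)}(Z₀) positive)] -/
theorem cE_pos (V : SliceInputsL2U 𝔇 χu χcu 𝒲 𝒪 c Sg Rz cs E₀ κE Z t W s₀ a a₅ ρb Mv) (b : (𝔇.𝒦 Z t).Λ) : 0 < V.cE :=
  ((𝔇.𝒦 Z t).hC.eigenvalues_pos b).trans_le (V.hc b)

variable {Y₀ Pl : Finset (𝔇.𝒦 Z t).Λ} {ε : ℝ}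

/-- **PRINT'S BOXES FORCE THE THRESHOLD LETTER**: `γ₂·rP²·|P| ≤ γ₂·|Pl|·(ε∕s₀)²` — `h222` tested at `B₀ = (ε∕s₀)·𝟙_{Pl}` where both boxes equal `1` — hence, under `|Pl| = |P| ≥ 1`,
`γ₂·rP² ≤ γ₂·(ε∕s₀)²`. [cite: Balaban1988RG2Cluster, (2.22) p.16 and (2.3) p.12] -/
theorem gamma2_mul_rP_sq_le (V : SliceInputsL2U 𝔇 χu χcu 𝒲 𝒪 c Sg Rz cs E₀ κE Z t W s₀ a a₅ ρb Mv)
    (hχu : ∀ A, χu Z t A = ∏ b ∈ Y₀, (if |A b| < ε then (1 : ℝ) else 0))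
    (hχcu : ∀ A, χcu Z t A = ∏ b ∈ Pl, (if ε ≤ |A b| then (1 : ℝ) else 0))
    (hdisj : Disjoint Y₀ Pl) (hPcard : Pl.card = t.2.card) (hP : t.2 ≠ ∅) (hε : 0 < ε) (hs : 0 < s₀) :
    V.γ₂ * V.rP ^ 2 ≤ V.γ₂ * (ε / s₀) ^ 2 := by
  classical
  set B₀ : (𝔇.𝒦 Z t).Λ → ℝ := fun b => if b ∈ Pl then ε / s₀ else 0 with hB₀
  have h1 : χu Z t (s₀ • B₀) = 1 := chi_smul_testField_eq_one (χu Z t) Y₀ Pl hε hχu hdisj s₀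
  have h2 : χcu Z t (s₀ • B₀) = 1 := chic_smul_testField_eq_one (χcu Z t) Pl hε.le hs hχcu
  have h222 := V.h222 B₀
  rw [h1, h2, one_mul] at h222
  -- `1 ≤ exp x ⇒ 0 ≤ x`
  have hx : 0 ≤ -(V.γ₂ / 2 * V.rP ^ 2 * (t.2.card : ℕ)) + V.γ₂ / 2 * V.qP B₀ := by
    by_contra hneg
    exact absurd h222 (not_le.2 (Real.exp_lt_one_iff.2 (not_le.1 hneg)))
  have hq : V.qP B₀ ≤ (Pl.card : ℝ) * (ε / s₀) ^ 2 := (V.hqP B₀).trans (testField_dotProduct Pl ε s₀).le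
  have hn : (1 : ℝ) ≤ (Pl.card : ℝ) := by
    have : Pl.card ≠ 0 := by rw [hPcard]; exact fun h => hP (Finset.card_eq_zero.1 h)
    exact_mod_cast Nat.one_le_iff_ne_zero.2 this
  rw [← hPcard] at hx
  have hγq : V.γ₂ / 2 * V.qP B₀ ≤ V.γ₂ / 2 * ((Pl.card : ℝ) * (ε / s₀) ^ 2) := mul_le_mul_of_nonneg_left hq (by linarith [V.hγ₂])
  -- `γ₂ rP² n ≤ γ₂ n (ε/s₀)²` with `n ≥ 1`
  have hmain : V.γ₂ * V.rP ^ 2 * (Pl.card : ℝ) ≤ V.γ₂ * (ε / s₀) ^ 2 * (Pl.card : ℝ) := by nlinarith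
  have hpos : 0 < (Pl.card : ℝ) := by linarith
  exact le_of_mul_le_mul_right hmain hpos

/-- **… hence `a ≤ γ₂·(ε∕s₀)²`** (`hPa : a ≤ γ₂rP²`). [cite: Balaban1988RG2Cluster, (2.22) p.16] -/
theorem a_le_gamma2_mul (V : SliceInputsL2U 𝔇 χu χcu 𝒲 𝒪 c Sg Rz cs E₀ κE Z t W s₀ a a₅ ρb Mv)
    (hχu : ∀ A, χu Z t A = ∏ b ∈ Y₀, (if |A b| < ε then (1 : ℝ) else 0))
    (hχcu : ∀ A, χcu Z t A = ∏ b ∈ Pl, (if ε ≤ |A b| then (1 : ℝ) else 0))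
    (hdisj : Disjoint Y₀ Pl) (hPcard : Pl.card = t.2.card) (hP : t.2 ≠ ∅) (hε : 0 < ε) (hs : 0 < s₀) :
    a ≤ V.γ₂ * (ε / s₀) ^ 2 :=
  V.hPa.trans (gamma2_mul_rP_sq_le V hχu hχcu hdisj hPcard hP hε hs)

/-- ★ **THE WINDOW CAP AT PRINT'S BOXES**: every inhabitant of the record at a large-field slice with print's boxes has `2·a·cE·s₀² ≤ ε²`. [cite: Balaban1988RG2Cluster, (2.22) p.16; Balaban1987RG1, §1 p.263] -/
theorem two_mul_a_mul_cE_mul_sq_le (V : SliceInputsL2U 𝔇 χu χcu 𝒲 𝒪 c Sg Rz cs E₀ κE Z t W s₀ a a₅ ρb Mv)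
    (hχu : ∀ A, χu Z t A = ∏ b ∈ Y₀, (if |A b| < ε then (1 : ℝ) else 0))
    (hχcu : ∀ A, χcu Z t A = ∏ b ∈ Pl, (if ε ≤ |A b| then (1 : ℝ) else 0))
    (hdisj : Disjoint Y₀ Pl) (hPcard : Pl.card = t.2.card) (hP : t.2 ≠ ∅) (hε : 0 < ε) (hs : 0 < s₀) :
    2 * a * V.cE * s₀ ^ 2 ≤ ε ^ 2 := by
  have ha := a_le_gamma2_mul V hχu hχcu hdisj hPcard hP hε hs
  have hγ := gamma2_mul_cE_le_half V
  have hcE := V.hc0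
  have hs2 : 0 < s₀ ^ 2 := by positivity
  -- `a cE ≤ γ₂ (ε/s₀)² cE ≤ ½ (ε/s₀)²`
  have h1 : a * V.cE ≤ V.γ₂ * (ε / s₀) ^ 2 * V.cE := mul_le_mul_of_nonneg_right ha hcE
  have h2 : V.γ₂ * (ε / s₀) ^ 2 * V.cE ≤ 1 / 2 * (ε / s₀) ^ 2 := by nlinarith [sq_nonneg (ε / s₀)]
  have h3 : a * V.cE * s₀ ^ 2 ≤ 1 / 2 * (ε / s₀) ^ 2 * s₀ ^ 2 := mul_le_mul_of_nonneg_right (h1.trans h2) hs2.le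
  have h4 : (ε / s₀) ^ 2 * s₀ ^ 2 = ε ^ 2 := by field_simp
  nlinarith [h3, h4]

/-- … in window form: for a positive gain, `s₀² ≤ ε² ∕ (2·a·cE)`. [cite: Balaban1988RG2Cluster, (2.22) p.16] -/
theorem sq_le_of_pos (V : SliceInputsL2U 𝔇 χu χcu 𝒲 𝒪 c Sg Rz cs E₀ κE Z t W s₀ a a₅ ρb Mv)
    (hχu : ∀ A, χu Z t A = ∏ b ∈ Y₀, (if |A b| < ε then (1 : ℝ) else 0))
    (hχcu : ∀ A, χcu Z t A = ∏ b ∈ Pl, (if ε ≤ |A b| then (1 : ℝ) else 0))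
    (hdisj : Disjoint Y₀ Pl) (hPcard : Pl.card = t.2.card) (hP : t.2 ≠ ∅) (hε : 0 < ε) (hs : 0 < s₀) (ha : 0 < a) :
    s₀ ^ 2 ≤ ε ^ 2 / (2 * a * V.cE) := by
  classical
  obtain ⟨b, hb⟩ : Pl.Nonempty := by
    rw [← Finset.card_pos, hPcard, Finset.card_pos]
    exact Finset.nonempty_iff_ne_empty.2 hP
  have hcE := cE_pos V b
  have h := two_mul_a_mul_cE_mul_sq_le V hχu hχcu hdisj hPcard hP hε hs
  rw [le_div_iff₀ (by positivity)]
  linarith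

end Inhabitant

/-! ## §3 With the socket's numerals: `a ≥ 80κ`, hence `160·κ·cE·s₀² ≤ ε²` -/

section Socket

/-- [II] Lemma 3's restriction R16 in the socket (`hR16′ : 4κ ≤ a∕20`): the gain is at least `80κ`. [cite: Balaban1988RG2Cluster, Lemma 3 p.20] -/
theorem eighty_kappa_le_a {c : B13.Consts} {M : ℕ} {ℓ a a₂ a₂' a₅ Aabs : ℝ} (hN : Lemma3Numerics c M ℓ a a₂ a₂' a₅ Aabs) : 80 * c.κ ≤ a := by
  have h := hN.hR16'
  linarith

variable {c₀ : B13.Consts} {P : Params} {𝔸 : Type*} [NormedRing 𝔸] [NormedAlgebra ℂ 𝔸] [CompleteSpace 𝔸] {M k L : ℕ} [NeZero L]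
  {𝔇 : TermDatum214 c₀ P 𝔸 M k L}
  {χu χcu : (Z : (domSys P M (k + 1)).Dom) → (t : TermLabel P M k L) → ((𝔇.𝒦 Z t).Λ → ℝ) → ℝ}
  {𝒲 : (Z : (domSys P M (k + 1)).Dom) → (t : TermLabel P M k L) → CPair P 𝔸 → TDom P.d (L * domCount P M (k + 1)) → ((𝔇.𝒦 Z t).Λ → ℝ) → ℂ}
  {𝒪 : (Z : (domSys P M (k + 1)).Dom) → (t : TermLabel P M k L) → OlderTerms P 𝔸 M k → CPair P 𝔸 → TDom P.d (L * domCount P M (k + 1)) →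
    ((𝔇.𝒦 Z t).Λ → ℝ) → ℂ}
  {c : B13.Consts} {G : Type*} [GaugeGroup G] {Sg : Setting 𝔸 G} {Rz : Residual P 𝔸} {cs : SFConsts} {E₀ κE : ℝ}
  {Z : (domSys P M (k + 1)).Dom} {t : TermLabel P M k L} {W : Set (CPair P 𝔸)} {s₀ a a₅ ρb Mv : ℝ}
  {Y₀ Pl : Finset (𝔇.𝒦 Z t).Λ} {ε : ℝ}

/-- ★ **THE SOCKET WINDOW CAP**: an inhabitant of the record at a large-field slice with print's boxes, at a gain carried by the socket numerals `Lemma3Numerics c M′ ℓ a …`, has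
`160·κ·cE·s₀² ≤ ε²` — the J-road runs at base points `s₀ ≤ ε ∕ √(160·κ·cE)` only (print's «g_k small against ε₁»). [cite: Balaban1988RG2Cluster, (2.22) p.16 and Lemma 3 p.20; Balaban1987RG1, §1 p.263] -/
theorem socket_window_cap (V : SliceInputsL2U 𝔇 χu χcu 𝒲 𝒪 c Sg Rz cs E₀ κE Z t W s₀ a a₅ ρb Mv)
    (hχu : ∀ A, χu Z t A = ∏ b ∈ Y₀, (if |A b| < ε then (1 : ℝ) else 0))
    (hχcu : ∀ A, χcu Z t A = ∏ b ∈ Pl, (if ε ≤ |A b| then (1 : ℝ) else 0))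
    (hdisj : Disjoint Y₀ Pl) (hPcard : Pl.card = t.2.card) (hP : t.2 ≠ ∅) (hε : 0 < ε) (hs : 0 < s₀)
    {M' : ℕ} {ℓ a₂ a₂' a₅' Aabs : ℝ} (hN : Lemma3Numerics c M' ℓ a a₂ a₂' a₅' Aabs) :
    160 * c.κ * V.cE * s₀ ^ 2 ≤ ε ^ 2 := by
  have h := two_mul_a_mul_cE_mul_sq_le V hχu hχcu hdisj hPcard hP hε hs
  have ha := eighty_kappa_le_a hN
  have hcs : 0 ≤ V.cE * s₀ ^ 2 := mul_nonneg V.hc0 (sq_nonneg _)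
  nlinarith

end Socket

end Summit.QuantumFields.YangMills.BalabanUVNodes.N22PrintedBoxBlock
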